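/-
Copyright: the b2b-balaban cell (near-miss cell 7), T⁴-continuum CRUX team (coordinator ruling e34b3e0c item (2)),
seat t4-ne7b-formalise-leaf-06 (gen 27). Released under the licence of the surrounding project.
-/
import Mathlib.Analysis.Quaternion
import Literature.MathematicalPhysics.QuantumFieldTheory.Sweep1
import Literature.MathematicalPhysics.QuantumFieldTheory.Federbush1986.PureAveragesSU2Lemma12
import HarnessLib

/-!
# Unit-quaternion algebra for PH-k: Euler–Lagrange linearity (β₁), the exact lattice Bianchi identity, and the
# second-order Bianchi defect bound (β₂) (route NE7b R-H, `t4/ROUTES-NE7b.md` v5 §2 PH-k ∕ §3 (T-k2), (T-k3))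

Cell `pub-balaban`, sub-cell `t4`, spine estimate NE7b (node U5c), candidate route R-H «Peierls healing map». ROUTES-NE7b
v5 (seat `t4-ne7b-idea-1` gen 5) proposes PH-k, a discrete Bochner–Weitzenböck barrier for the interior-free `SU(2)`
minimiser (`SU(2) ≅` unit quaternions, `E_p := Im U_p`, `s_p = |E_p| = sin θ_p`). Two of its four «facts about one
configuration» are flagged «[K-claim]» and offered as kernel items (v5 §3): (T-k2) = (β₁) «EULER–LAGRANGE, EXACT AND LINEAR
IN E: criticality of `U ↦ Re tr(U·S)` on `SU(2)` at `U₀` ⇔ `Im(U₀S) = 0` (… `Re tr(Xq) = −2⟨x, Im q⟩` for quaternions)»,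
and (T-k3) = (β₂) «BIANCHI WITH DEFECT: for every elementary 3-cube the signed sum of the six face-`E`'s transported to the
base point equals `Q_c` with `|Q_c| ≤ C_B·m_c²` (the cube's boundary holonomy word is EXACTLY `1`; expand the ordered
product of six unit quaternions to second order)». THIS FILE PROVES their algebraic cores, law-free:

* §1 (β₁): `re_mul_of_re_eq_zero` (`Re(Xq) = −⟨Im X, Im q⟩` for pure imaginary `X`), **`critical_iff_im_eq_zero`**
  (`(∀ X pure imaginary, Re((X·U₀)·S) = 0) ↔ Im(U₀·S) = 0` — the map `U ↦ Re(U·S)` is `ℝ`-linear, so its differential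
  along the tangent vector `X·U₀` IS `Re((X·U₀)·S)`), `tangent_iff` (for `‖U₀‖ = 1` the tangent vectors `V`,
  `Re(V·U₀*) = 0`, are exactly the `X·U₀` with `X` pure imaginary);
* §2 a normed-ring expansion bound: **`norm_prod_sub_one_sub_sum_le`** —
  `‖Π(1+rᵢ) − 1 − Σ rᵢ‖ ≤ (1+ρ)^n − 1 − nρ` when all `‖rᵢ‖ ≤ ρ` (ordered `List` product, any normed ring);
* §3 unit quaternions with non-negative real part: `norm_sub_one_sq_le` — `‖q − 1‖² ≤ 2‖Im q‖²`
  (Bałaban's `|U − 1|` against the sine-curvature `s = |Im U|`, the «factor `1 + O(θ²)`» of v5 (α));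
* §4 (β₂) core: **`norm_sum_im_le_of_prod_eq_one`** — unit quaternions `q₁ … q_n` with `Re qᵢ ≥ 0`, `‖Im qᵢ‖ ≤ m` and
  `q₁⋯q_n = 1` have `‖Σ Im qᵢ‖ ≤ (1 + √2·m)^n − 1 − n·√2·m`; for a cube (`n = 6`, `m ≤ ½`): **`≤ 114·m²`**
  (`norm_sum_im_six_le`) — an explicit `C_B`;
* §5 the EXACT lattice Bianchi identity behind it, in ANY group: `cube_word_eq_one` (twelve edge variables, by `group`) and
  **`ZdGaugeConfig.bianchi_cube`** — for `U : ZdGaugeConfig d G` and directions `i, j, k`: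
  `P_{ij}(x) · [U(x,j) P_{ik}(x+e_j) U(x,j)⁻¹] · P_{jk}(x) · [U(x,k) P_{ij}(x+e_k) U(x,k)⁻¹]⁻¹ · P_{ik}(x)⁻¹ · [U(x,i) P_{jk}(x+e_i) U(x,i)⁻¹]⁻¹ = 1`
  (`P = ZdGaugeConfig.plaquette`; three faces at the base point, three far faces transported along one edge, three inverted
  — the «signed, transported» six of (β₂)).

HONEST FRAMING. Pure algebra (quaternions ∕ groups); says nothing about (β₄)'s constant `C′_d`, about (MP<L²), PH-c⁺ or
anything of [Bałaban 1983–89]; the identification `SU(2) ≅` unit quaternions is NOT formalised here (the tree's gauge group is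
`Matrix.specialUnitaryGroup (Fin 2) ℂ`; §5 holds for every group, §1–§4 are stated for Mathlib's `ℍ[ℝ]`). v5 §3 sequences
(T-k2)∕(T-k3) after the refuter's price of PH-k «unless a leaf is idle» — this seat was idle; the lemmas are price-independent.
NE7b (`T4WeightBudget.RelWeightBound`) NOT PRINTED, NOT PROVED; spine PROVED 0∕9; rung (B)+1 on a FINITE torus T⁴ — NOT
infinite volume, NOT the mass gap, NOT Clay. HONEST DEPENDENCY: continuum YM on T⁴ ⇐ BetaPertH ∧ nine spine estimates (0/9
proved); BetaPertH ⇐ (D1) ∧ (D4) ∧ CAP+tail; G-an2-4 gates asym, D1 and NE2/3/4. POLICY: crux-route work under `Spine/NE7b/`,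
not a `T4Continuum/Support` leaf (FREEZE (0) respected); no definition, no `Prop`-valued fact, no `[cite:]` fact.
-/

set_option autoImplicit false

namespace Summit.QuantumFields.BalabanUV.T4Continuum.NE7b.QuaternionBianchiDefect

open Quaternion
open scoped Quaternion

/-! ## §1 (β₁): Euler–Lagrange linearity on the unit quaternions -/

/-- `Re(X·q) = −⟨Im X, Im q⟩` for pure imaginary `X`. -/
theorem re_mul_of_re_eq_zero (X q : ℍ) (hX : X.re = 0) :
    (X * q).re = -(X.imI * q.imI + X.imJ * q.imJ + X.imK * q.imK) := by
  rw [Quaternion.re_mul, hX]; ring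

/-- `Im q = 0 ↔` the three imaginary coordinates vanish. -/
theorem im_eq_zero_iff (q : ℍ) : q.im = 0 ↔ q.imI = 0 ∧ q.imJ = 0 ∧ q.imK = 0 := by
  constructor
  · intro h
    exact ⟨by rw [← Quaternion.imI_im, h]; rfl, by rw [← Quaternion.imJ_im, h]; rfl, by rw [← Quaternion.imK_im, h]; rfl⟩
  · rintro ⟨h1, h2, h3⟩
    ext <;> simp [h1, h2, h3]

/-- **(β₁) EULER–LAGRANGE LINEARITY.** For quaternions `U₀, S` (a link variable and the sum of its staples): `U₀` is critical
for the `ℝ`-linear function `U ↦ Re(U·S)` along every tangent direction `X·U₀` of the unit sphere (`X` pure imaginary) iff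
`Im(U₀·S) = 0` — the lattice Yang–Mills equation is LINEAR in the sine-curvatures, with no small-field hypothesis. -/
theorem critical_iff_im_eq_zero (U₀ S : ℍ) :
    (∀ X : ℍ, X.re = 0 → ((X * U₀) * S).re = 0) ↔ (U₀ * S).im = 0 := by
  rw [im_eq_zero_iff]
  constructor
  · intro h
    have hI := h ⟨0, 1, 0, 0⟩ rfl
    have hJ := h ⟨0, 0, 1, 0⟩ rfl
    have hK := h ⟨0, 0, 0, 1⟩ rfl
    rw [mul_assoc, re_mul_of_re_eq_zero _ _ rfl] at hI hJ hK
    simp only [one_mul, zero_mul, add_zero, zero_add, neg_eq_zero] at hI hJ hK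
    exact ⟨hI, hJ, hK⟩
  · rintro ⟨h1, h2, h3⟩ X hX
    rw [mul_assoc, re_mul_of_re_eq_zero X _ hX, h1, h2, h3]
    ring

/-- The tangent space of the unit sphere at `U₀` (`‖U₀‖ = 1`): `Re(V·U₀*) = 0` iff `V = X·U₀` with `X` pure imaginary. -/
theorem tangent_iff (U₀ V : ℍ) (hU : ‖U₀‖ = 1) :
    (V * star U₀).re = 0 ↔ ∃ X : ℍ, X.re = 0 ∧ V = X * U₀ := by
  have hn : normSq U₀ = 1 := by rw [Quaternion.normSq_eq_norm_mul_self, hU, mul_one]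
  have hsu : star U₀ * U₀ = 1 := by rw [Quaternion.star_mul_self, hn]; norm_cast
  constructor
  · intro h
    refine ⟨V * star U₀, h, ?_⟩
    rw [mul_assoc, hsu, mul_one]
  · rintro ⟨X, hX, rfl⟩
    have hus : U₀ * star U₀ = 1 := by rw [Quaternion.self_mul_star, hn]; norm_cast
    rw [mul_assoc, hus, mul_one]
    exact hX

/-! ## §2 Expanding an ordered product of near-identity elements to second order -/

section Expansion

variable {R : Type*} [NormedRing R]

/-- Ordered product and sum of a list with a uniform bound `ρ` on the terms: `‖Π(1+rᵢ) − 1‖ ≤ (1+ρ)^n − 1` and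
`‖Π(1+rᵢ) − 1 − Σ rᵢ‖ ≤ (1+ρ)^n − 1 − nρ`. -/
theorem norm_prod_sub_one_le_and (l : List R) {ρ : ℝ} (hρ : 0 ≤ ρ) (h : ∀ r ∈ l, ‖r‖ ≤ ρ) :
    ‖(l.map (1 + ·)).prod - 1‖ ≤ (1 + ρ) ^ l.length - 1 ∧
      ‖(l.map (1 + ·)).prod - 1 - l.sum‖ ≤ (1 + ρ) ^ l.length - 1 - l.length * ρ := by
  induction l with
  | nil => simp
  | cons r l ih =>
    have hr : ‖r‖ ≤ ρ := h r (by simp)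
    obtain ⟨ih1, ih2⟩ := ih fun r' hr' => h r' (by simp [hr'])
    set P := (l.map (1 + ·)).prod with hP
    have hpow : 0 ≤ (1 + ρ) ^ l.length - 1 := by
      have : (1 : ℝ) ≤ (1 + ρ) ^ l.length := one_le_pow₀ (by linarith)
      linarith
    simp only [List.map_cons, List.prod_cons, List.sum_cons, List.length_cons, pow_succ, Nat.cast_succ]
    rw [← hP]
    constructor
    · -- `(1+r)P − 1 = (P − 1) + r·(P − 1) + r`
      have e : (1 + r) * P - 1 = (P - 1) + r * (P - 1) + r := by noncomm_ring
      rw [e]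
      calc ‖P - 1 + r * (P - 1) + r‖ ≤ ‖P - 1‖ + ‖r * (P - 1)‖ + ‖r‖ := norm_add₃_le
        _ ≤ ‖P - 1‖ + ‖r‖ * ‖P - 1‖ + ‖r‖ := by gcongr; exact norm_mul_le _ _
        _ ≤ ((1 + ρ) ^ l.length - 1) + ρ * ((1 + ρ) ^ l.length - 1) + ρ := by
            gcongr
        _ = (1 + ρ) ^ l.length * (1 + ρ) - 1 := by ring
    · -- `(1+r)P − 1 − (r + Σ) = (P − 1 − Σ) + r·(P − 1)`
      have e : (1 + r) * P - 1 - (r + l.sum) = (P - 1 - l.sum) + r * (P - 1) := by noncomm_ring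
      rw [e]
      calc ‖P - 1 - l.sum + r * (P - 1)‖ ≤ ‖P - 1 - l.sum‖ + ‖r * (P - 1)‖ := norm_add_le _ _
        _ ≤ ‖P - 1 - l.sum‖ + ‖r‖ * ‖P - 1‖ := by gcongr; exact norm_mul_le _ _
        _ ≤ ((1 + ρ) ^ l.length - 1 - l.length * ρ) + ρ * ((1 + ρ) ^ l.length - 1) := by gcongr
        _ = (1 + ρ) ^ l.length * (1 + ρ) - 1 - (l.length + 1) * ρ := by ring

/-- **`‖Π(1+rᵢ) − 1 − Σ rᵢ‖ ≤ (1+ρ)^n − 1 − nρ`** for an ordered product in a normed ring, all `‖rᵢ‖ ≤ ρ`. -/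
theorem norm_prod_sub_one_sub_sum_le (l : List R) {ρ : ℝ} (hρ : 0 ≤ ρ) (h : ∀ r ∈ l, ‖r‖ ≤ ρ) :
    ‖(l.map (1 + ·)).prod - 1 - l.sum‖ ≤ (1 + ρ) ^ l.length - 1 - l.length * ρ :=
  (norm_prod_sub_one_le_and l hρ h).2

end Expansion

/-! ## §3 Unit quaternions with non-negative real part: chord versus sine -/

-- `‖Im q‖ ≤ ‖q‖` is the tree's `Federbush1986.SU2.norm_im_le` (imported, not restated).

/-- `Im` is additive on lists: `(Σ qᵢ).im = Σ qᵢ.im`. -/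
theorem im_list_sum (l : List ℍ) : l.sum.im = (l.map Quaternion.im).sum := by
  induction l with
  | nil => simp
  | cons q l ih => simp [ih]

/-- **Chord versus sine-curvature**: a unit quaternion with non-negative real part satisfies `‖q − 1‖² ≤ 2‖Im q‖²`
(`1 − Re q ≤ 1 − (Re q)² = ‖Im q‖²`). -/
theorem norm_sub_one_sq_le (q : ℍ) (hq : ‖q‖ = 1) (hre : 0 ≤ q.re) : ‖q - 1‖ ^ 2 ≤ 2 * ‖q.im‖ ^ 2 := by
  have hn : q.re ^ 2 + q.imI ^ 2 + q.imJ ^ 2 + q.imK ^ 2 = 1 := by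
    rw [← Quaternion.normSq_def', Quaternion.normSq_eq_norm_mul_self, hq, mul_one]
  have h1 : ‖q - 1‖ ^ 2 = (q.re - 1) ^ 2 + q.imI ^ 2 + q.imJ ^ 2 + q.imK ^ 2 := by
    rw [sq, ← Quaternion.normSq_eq_norm_mul_self, Quaternion.normSq_def']
    simp
  have h2 : ‖q.im‖ ^ 2 = q.imI ^ 2 + q.imJ ^ 2 + q.imK ^ 2 := by
    rw [sq, ← Quaternion.normSq_eq_norm_mul_self, Quaternion.normSq_def']
    simp
  have hre1 : q.re ≤ 1 := by nlinarith [sq_nonneg q.imI, sq_nonneg q.imJ, sq_nonneg q.imK]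
  rw [h1, h2]
  nlinarith

/-- Hence `‖q − 1‖ ≤ √2·‖Im q‖`. -/
theorem norm_sub_one_le (q : ℍ) (hq : ‖q‖ = 1) (hre : 0 ≤ q.re) : ‖q - 1‖ ≤ Real.sqrt 2 * ‖q.im‖ := by
  have h := norm_sub_one_sq_le q hq hre
  have h2 : (Real.sqrt 2 * ‖q.im‖) ^ 2 = 2 * ‖q.im‖ ^ 2 := by
    rw [mul_pow, Real.sq_sqrt (by norm_num : (0:ℝ) ≤ 2)]
  exact (pow_le_pow_iff_left₀ (norm_nonneg _) (by positivity) two_ne_zero).1 (h2 ▸ h)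

/-! ## §4 (β₂) core: the Bianchi defect is second order -/

/-- `Im (q − 1) = Im q`. -/
theorem im_sub_one (q : ℍ) : (q - 1).im = q.im := by
  ext <;> simp

/-- **(β₂) CORE — THE BIANCHI DEFECT BOUND.** If unit quaternions `q₁, …, q_n` with `Re qᵢ ≥ 0` and sine-curvatures
`‖Im qᵢ‖ ≤ m` multiply (in order) to `1`, then their imaginary parts sum to a SECOND-ORDER quantity:
`‖Σᵢ Im qᵢ‖ ≤ (1 + √2·m)^n − 1 − n·√2·m`. (Apply to the six transported, signed face holonomies of a lattice 3-cube, whose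
ordered product is exactly `1` by `ZdGaugeConfig.bianchi_cube`; transport rotates `Im`, inversion negates it.) -/
theorem norm_sum_im_le_of_prod_eq_one (l : List ℍ) {m : ℝ} (hm : 0 ≤ m) (hunit : ∀ q ∈ l, ‖q‖ = 1)
    (hre : ∀ q ∈ l, 0 ≤ q.re) (him : ∀ q ∈ l, ‖q.im‖ ≤ m) (hprod : l.prod = 1) :
    ‖(l.map Quaternion.im).sum‖ ≤ (1 + Real.sqrt 2 * m) ^ l.length - 1 - l.length * (Real.sqrt 2 * m) := by
  -- `rᵢ := qᵢ − 1`, `‖rᵢ‖ ≤ √2 m`, `Π(1 + rᵢ) = Π qᵢ = 1`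
  set r : List ℍ := l.map (· - 1) with hr
  have hρ : 0 ≤ Real.sqrt 2 * m := by positivity
  have hbd : ∀ x ∈ r, ‖x‖ ≤ Real.sqrt 2 * m := by
    intro x hx
    obtain ⟨q, hq, rfl⟩ := List.mem_map.1 hx
    exact (norm_sub_one_le q (hunit q hq) (hre q hq)).trans (mul_le_mul_of_nonneg_left (him q hq) (Real.sqrt_nonneg _))
  have hmap : r.map (1 + ·) = l := by
    simp [hr, List.map_map, Function.comp_def]
  have hlen : r.length = l.length := by rw [hr, List.length_map]
  have key := norm_prod_sub_one_sub_sum_le r hρ hbd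
  rw [hmap, hprod, sub_self, zero_sub, norm_neg, hlen] at key
  -- `(Σ rᵢ).im = Σ qᵢ.im` and `‖(Σ rᵢ).im‖ ≤ ‖Σ rᵢ‖`
  have hsum_im : r.sum.im = (l.map Quaternion.im).sum := by
    rw [im_list_sum, hr, List.map_map]
    congr 1
    simp [Function.comp_def]
  rw [← hsum_im]
  exact (Literature.MathematicalPhysics.QuantumFieldTheory.Federbush1986.SU2.norm_im_le _).trans key

/-- `(1 + x)⁶ − 1 − 6x ≤ 57x²` for `0 ≤ x ≤ 1` (the binomial coefficients beyond the linear term sum to `57`). -/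
theorem pow_six_expansion_le {x : ℝ} (h0 : 0 ≤ x) (h1 : x ≤ 1) : (1 + x) ^ 6 - 1 - 6 * x ≤ 57 * x ^ 2 := by
  nlinarith [mul_nonneg h0 h0, pow_nonneg h0 3, pow_nonneg h0 4, pow_nonneg h0 5, pow_nonneg h0 6,
    mul_le_mul_of_nonneg_left h1 (pow_nonneg h0 2), mul_le_mul_of_nonneg_left h1 (pow_nonneg h0 3),
    mul_le_mul_of_nonneg_left h1 (pow_nonneg h0 4), mul_le_mul_of_nonneg_left h1 (pow_nonneg h0 5)]

/-- **THE CUBE CASE WITH AN EXPLICIT CONSTANT**: six unit quaternions with `Re ≥ 0`, sine-curvatures `≤ m ≤ ½` and ordered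
product `1` have `‖Σ Im qᵢ‖ ≤ 114·m²` — a kernel value for (β₂)'s `C_B` (crude: `57·(√2)² = 114`). -/
theorem norm_sum_im_six_le (l : List ℍ) {m : ℝ} (hm : 0 ≤ m) (hm2 : m ≤ 1 / 2) (hl : l.length = 6)
    (hunit : ∀ q ∈ l, ‖q‖ = 1) (hre : ∀ q ∈ l, 0 ≤ q.re) (him : ∀ q ∈ l, ‖q.im‖ ≤ m) (hprod : l.prod = 1) :
    ‖(l.map Quaternion.im).sum‖ ≤ 114 * m ^ 2 := by
  have h := norm_sum_im_le_of_prod_eq_one l hm hunit hre him hprod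
  rw [hl] at h
  have hx0 : 0 ≤ Real.sqrt 2 * m := by positivity
  have hs2 : Real.sqrt 2 ≤ 2 := by
    rw [show (2 : ℝ) = Real.sqrt 4 by rw [show (4:ℝ) = 2 ^ 2 by norm_num, Real.sqrt_sq (by norm_num)]]
    exact Real.sqrt_le_sqrt (by norm_num)
  have hx1 : Real.sqrt 2 * m ≤ 1 := by nlinarith [Real.sqrt_nonneg 2]
  have h6 := pow_six_expansion_le hx0 hx1
  have hsq : (Real.sqrt 2 * m) ^ 2 = 2 * m ^ 2 := by rw [mul_pow, Real.sq_sqrt (by norm_num : (0:ℝ) ≤ 2)]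
  push_cast at h
  nlinarith [h, h6, hsq]

/-! ## §5 The exact lattice Bianchi identity (any group) -/

section Bianchi

variable {G : Type*} [Group G]

/-- **THE CUBE WORD IS TRIVIAL** (free-group identity behind the lattice Bianchi identity): with the twelve edge variables of
a 3-cube — `a = U(x,i)`, `b = U(x,j)`, `c = U(x,k)`, `d = U(x+eᵢ,j)`, `e = U(x+eᵢ,k)`, `f = U(x+eⱼ,i)`, `g = U(x+eⱼ,k)`,
`h = U(x+e_k,i)`, `l = U(x+e_k,j)`, `m = U(x+eᵢ+eⱼ,k)`, `n = U(x+eᵢ+e_k,j)`, `o = U(x+eⱼ+e_k,i)` — the ordered product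
`P_{ij} · (b P_{ik}(x+eⱼ) b⁻¹) · P_{jk} · (c P_{ij}(x+e_k) c⁻¹)⁻¹ · P_{ik}⁻¹ · (a P_{jk}(x+eᵢ) a⁻¹)⁻¹` is `1`. -/
theorem cube_word_eq_one (a b c d e f g h l m n o : G) :
    (a * d * f⁻¹ * b⁻¹) * (b * (f * m * o⁻¹ * g⁻¹) * b⁻¹) * (b * g * l⁻¹ * c⁻¹) *
        (c * (h * n * o⁻¹ * l⁻¹) * c⁻¹)⁻¹ * (a * e * h⁻¹ * c⁻¹)⁻¹ * (a * (d * m * n⁻¹ * e⁻¹) * a⁻¹)⁻¹ = 1 := by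
  group

open Literature.MathematicalPhysics.QuantumFieldTheory (ZdEdge ZdGaugeConfig)
open Literature.Probability.LatticeModels (Site)

/-- **THE LATTICE BIANCHI IDENTITY** for `ZdGaugeConfig.plaquette` (`P_{μν}(x) = U(x,μ)U(x+e_μ,ν)U(x+e_ν,μ)⁻¹U(x,ν)⁻¹`), any
group, any `d`, any three directions: three faces of the cube at its base point, the three far faces transported to the base
point along one edge, three of the six inverted — their ordered product is EXACTLY `1`. For `G = SU(2)` these six unit
quaternions are (β₂)'s «signed, transported face holonomies». -/
theorem ZdGaugeConfig.bianchi_cube {d : ℕ} (U : ZdGaugeConfig d G) (x : Site d) (i j k : Fin d) :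
    ZdGaugeConfig.plaquette U x i j *
      (U (x, j) * ZdGaugeConfig.plaquette U (x + Pi.single j 1) i k * (U (x, j))⁻¹) *
      ZdGaugeConfig.plaquette U x j k *
      (U (x, k) * ZdGaugeConfig.plaquette U (x + Pi.single k 1) i j * (U (x, k))⁻¹)⁻¹ *
      (ZdGaugeConfig.plaquette U x i k)⁻¹ *
      (U (x, i) * ZdGaugeConfig.plaquette U (x + Pi.single i 1) j k * (U (x, i))⁻¹)⁻¹ = 1 := by
  have h1 : x + Pi.single j 1 + Pi.single i 1 = x + Pi.single i 1 + Pi.single j 1 := add_right_comm _ _ _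
  have h2 : x + Pi.single k 1 + Pi.single i 1 = x + Pi.single i 1 + Pi.single k 1 := add_right_comm _ _ _
  have h3 : x + Pi.single k 1 + Pi.single j 1 = x + Pi.single j 1 + Pi.single k 1 := add_right_comm _ _ _
  simp only [ZdGaugeConfig.plaquette, h1, h2, h3]
  exact cube_word_eq_one _ _ _ _ _ _ _ _ _ _ _ _

end Bianchi


/-! ## §6 (β₂) on the lattice for unit-quaternion configurations -/

section LatticeCube

open Literature.MathematicalPhysics.QuantumFieldTheory (ZdEdge ZdGaugeConfig)
open Literature.Probability.LatticeModels (Site)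

-- The unit quaternions `(Metric.sphere (0 : ℍ) 1) ⊂ ℍ` as a group are Mathlib's `(Metric.sphere (0 : ℍ) 1)` (our model of `SU(2)` here).

/-- Elements of `(Metric.sphere (0 : ℍ) 1)` have norm `1`. -/
theorem norm_coe_sphere (q : (Metric.sphere (0 : ℍ) 1)) : ‖(q : ℍ)‖ = 1 := by simp

/-- In `(Metric.sphere (0 : ℍ) 1)` the inverse is the conjugate. -/
theorem coe_inv_eq_star (q : (Metric.sphere (0 : ℍ) 1)) : ((q⁻¹ : (Metric.sphere (0 : ℍ) 1)) : ℍ) = star (q : ℍ) := by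
  have hn : normSq (q : ℍ) = 1 := by
    rw [Quaternion.normSq_eq_norm_mul_self, norm_coe_sphere, mul_one]
  rw [Metric.unitSphere.coe_inv, Quaternion.inv_def, hn, inv_one, one_smul]

/-- Inversion keeps the real part … -/
theorem re_coe_inv (q : (Metric.sphere (0 : ℍ) 1)) : ((q⁻¹ : (Metric.sphere (0 : ℍ) 1)) : ℍ).re = (q : ℍ).re := by
  rw [coe_inv_eq_star, Quaternion.re_star]

/-- … and negates the imaginary part («signed»). -/
theorem im_coe_inv (q : (Metric.sphere (0 : ℍ) 1)) : ((q⁻¹ : (Metric.sphere (0 : ℍ) 1)) : ℍ).im = -(q : ℍ).im := by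
  rw [coe_inv_eq_star, Quaternion.im_star]

/-- Transport (conjugation) keeps the real part … -/
theorem re_coe_conj (g p : (Metric.sphere (0 : ℍ) 1)) : ((g * p * g⁻¹ : (Metric.sphere (0 : ℍ) 1)) : ℍ).re = (p : ℍ).re := by
  -- `Re(ab) = Re(ba)` in `ℍ` (the tree's `Literature.Geometry.GaugeTheory.BPST.re_mul_comm`; re-derived inline to keep imports light)
  have re_mul_comm : ∀ a b : ℍ, (a * b).re = (b * a).re := fun a b => by
    rw [Quaternion.re_mul, Quaternion.re_mul]; ring
  rw [Metric.unitSphere.coe_mul, Metric.unitSphere.coe_mul, re_mul_comm, ← mul_assoc, ← Metric.unitSphere.coe_mul,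
    inv_mul_cancel, Metric.unitSphere.coe_one, one_mul]

/-- … and the length of the imaginary part («transported `E` = rotated `E`»). -/
theorem norm_im_coe_conj (g p : (Metric.sphere (0 : ℍ) 1)) : ‖((g * p * g⁻¹ : (Metric.sphere (0 : ℍ) 1)) : ℍ).im‖ = ‖(p : ℍ).im‖ := by
  have hg : ‖(g : ℍ)‖ = 1 := norm_coe_sphere g
  have hgs : (g : ℍ) * star (g : ℍ) = 1 := by
    rw [Quaternion.self_mul_star, Quaternion.normSq_eq_norm_mul_self, hg, mul_one]; norm_cast
  have key : ((g * p * g⁻¹ : (Metric.sphere (0 : ℍ) 1)) : ℍ).im = (g : ℍ) * (p : ℍ).im * star (g : ℍ) := by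
    rw [← Quaternion.sub_re_self, re_coe_conj, Metric.unitSphere.coe_mul, Metric.unitSphere.coe_mul, coe_inv_eq_star,
      ← Quaternion.sub_re_self]
    have hc : (g : ℍ) * ((p : ℍ).re : ℍ) * star (g : ℍ) = ((p : ℍ).re : ℍ) := by
      rw [← Quaternion.coe_commutes (p : ℍ).re (g : ℍ), mul_assoc, hgs, mul_one]
    rw [mul_sub, sub_mul, hc]
  rw [key, norm_mul, norm_mul, Quaternion.norm_star, hg, one_mul, mul_one]

/-- **(β₂) ON THE LATTICE — THE BIANCHI DEFECT OF A 3-CUBE IS SECOND ORDER.** Let `U` be a unit-quaternion configuration on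
`ℤ^d` and consider the 3-cube at `x` in directions `i, j, k`. If its six FACE holonomies (three at `x`, three on the far faces)
have non-negative real part and sine-curvature `‖Im ·‖ ≤ m ≤ ½`, then the six «signed, transported» faces of
`ZdGaugeConfig.bianchi_cube` — whose ordered product is exactly `1` — have `‖Σ Im‖ ≤ 114·m²`: the signed sum of the face
`E`'s transported to the base point is `O(m²)` with the explicit constant `C_B = 114`. -/
theorem bianchi_defect_cube {d : ℕ} (U : ZdGaugeConfig d (Metric.sphere (0 : ℍ) 1)) (x : Site d) (i j k : Fin d) {m : ℝ} (hm : 0 ≤ m)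
    (hm2 : m ≤ 1 / 2)
    (hre : ∀ q ∈ [ZdGaugeConfig.plaquette U x i j, ZdGaugeConfig.plaquette U (x + Pi.single j 1) i k,
        ZdGaugeConfig.plaquette U x j k, ZdGaugeConfig.plaquette U (x + Pi.single k 1) i j,
        ZdGaugeConfig.plaquette U x i k, ZdGaugeConfig.plaquette U (x + Pi.single i 1) j k], 0 ≤ (q : ℍ).re)
    (him : ∀ q ∈ [ZdGaugeConfig.plaquette U x i j, ZdGaugeConfig.plaquette U (x + Pi.single j 1) i k,
        ZdGaugeConfig.plaquette U x j k, ZdGaugeConfig.plaquette U (x + Pi.single k 1) i j,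
        ZdGaugeConfig.plaquette U x i k, ZdGaugeConfig.plaquette U (x + Pi.single i 1) j k], ‖(q : ℍ).im‖ ≤ m) :
    ‖(([ZdGaugeConfig.plaquette U x i j,
        U (x, j) * ZdGaugeConfig.plaquette U (x + Pi.single j 1) i k * (U (x, j))⁻¹,
        ZdGaugeConfig.plaquette U x j k,
        (U (x, k) * ZdGaugeConfig.plaquette U (x + Pi.single k 1) i j * (U (x, k))⁻¹)⁻¹,
        (ZdGaugeConfig.plaquette U x i k)⁻¹,
        (U (x, i) * ZdGaugeConfig.plaquette U (x + Pi.single i 1) j k * (U (x, i))⁻¹)⁻¹] : List (Metric.sphere (0 : ℍ) 1)).map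
        fun q => ((q : (Metric.sphere (0 : ℍ) 1)) : ℍ).im).sum‖ ≤ 114 * m ^ 2 := by
  set P₁ := ZdGaugeConfig.plaquette U x i j
  set P₂ := ZdGaugeConfig.plaquette U (x + Pi.single j 1) i k
  set P₃ := ZdGaugeConfig.plaquette U x j k
  set P₄ := ZdGaugeConfig.plaquette U (x + Pi.single k 1) i j
  set P₅ := ZdGaugeConfig.plaquette U x i k
  set P₆ := ZdGaugeConfig.plaquette U (x + Pi.single i 1) j k
  set q₂ : (Metric.sphere (0 : ℍ) 1) := U (x, j) * P₂ * (U (x, j))⁻¹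
  set q₄ : (Metric.sphere (0 : ℍ) 1) := (U (x, k) * P₄ * (U (x, k))⁻¹)⁻¹
  set q₅ : (Metric.sphere (0 : ℍ) 1) := P₅⁻¹
  set q₆ : (Metric.sphere (0 : ℍ) 1) := (U (x, i) * P₆ * (U (x, i))⁻¹)⁻¹
  have hprodS : P₁ * q₂ * P₃ * q₄ * q₅ * q₆ = 1 := ZdGaugeConfig.bianchi_cube U x i j k
  -- the list of the six coerced quaternions
  let L : List ℍ := [(P₁ : ℍ), (q₂ : ℍ), (P₃ : ℍ), (q₄ : ℍ), (q₅ : ℍ), (q₆ : ℍ)]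
  have hL : (([P₁, q₂, P₃, q₄, q₅, q₆] : List (Metric.sphere (0 : ℍ) 1)).map fun q => ((q : (Metric.sphere (0 : ℍ) 1)) : ℍ).im) = L.map Quaternion.im := by
    simp [L]
  rw [hL]
  have hprod : L.prod = 1 := by
    have := congrArg (fun q : (Metric.sphere (0 : ℍ) 1) => (q : ℍ)) hprodS
    simpa [L, Metric.unitSphere.coe_mul, mul_assoc] using this
  -- real parts and sine-curvatures of the six: inherited from the faces
  have hre' : ∀ q ∈ L, 0 ≤ q.re := by
    intro q hq
    simp only [L, List.mem_cons, List.mem_nil_iff, or_false] at hq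
    rcases hq with rfl | rfl | rfl | rfl | rfl | rfl
    · exact hre P₁ (by simp)
    · rw [show ((q₂ : (Metric.sphere (0 : ℍ) 1)) : ℍ).re = ((P₂ : (Metric.sphere (0 : ℍ) 1)) : ℍ).re from re_coe_conj _ _]; exact hre P₂ (by simp)
    · exact hre P₃ (by simp)
    · rw [show ((q₄ : (Metric.sphere (0 : ℍ) 1)) : ℍ).re = ((P₄ : (Metric.sphere (0 : ℍ) 1)) : ℍ).re by rw [re_coe_inv, re_coe_conj]]; exact hre P₄ (by simp)
    · rw [show ((q₅ : (Metric.sphere (0 : ℍ) 1)) : ℍ).re = ((P₅ : (Metric.sphere (0 : ℍ) 1)) : ℍ).re from re_coe_inv _]; exact hre P₅ (by simp)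
    · rw [show ((q₆ : (Metric.sphere (0 : ℍ) 1)) : ℍ).re = ((P₆ : (Metric.sphere (0 : ℍ) 1)) : ℍ).re by rw [re_coe_inv, re_coe_conj]]; exact hre P₆ (by simp)
  have him' : ∀ q ∈ L, ‖q.im‖ ≤ m := by
    intro q hq
    simp only [L, List.mem_cons, List.mem_nil_iff, or_false] at hq
    rcases hq with rfl | rfl | rfl | rfl | rfl | rfl
    · exact him P₁ (by simp)
    · rw [show ‖((q₂ : (Metric.sphere (0 : ℍ) 1)) : ℍ).im‖ = ‖((P₂ : (Metric.sphere (0 : ℍ) 1)) : ℍ).im‖ from norm_im_coe_conj _ _]; exact him P₂ (by simp)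
    · exact him P₃ (by simp)
    · rw [show ‖((q₄ : (Metric.sphere (0 : ℍ) 1)) : ℍ).im‖ = ‖((P₄ : (Metric.sphere (0 : ℍ) 1)) : ℍ).im‖ by rw [im_coe_inv, norm_neg, norm_im_coe_conj]]
      exact him P₄ (by simp)
    · rw [show ‖((q₅ : (Metric.sphere (0 : ℍ) 1)) : ℍ).im‖ = ‖((P₅ : (Metric.sphere (0 : ℍ) 1)) : ℍ).im‖ by rw [im_coe_inv, norm_neg]]; exact him P₅ (by simp)
    · rw [show ‖((q₆ : (Metric.sphere (0 : ℍ) 1)) : ℍ).im‖ = ‖((P₆ : (Metric.sphere (0 : ℍ) 1)) : ℍ).im‖ by rw [im_coe_inv, norm_neg, norm_im_coe_conj]]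
      exact him P₆ (by simp)
  have hunit : ∀ q ∈ L, ‖q‖ = 1 := by
    intro q hq
    simp only [L, List.mem_cons, List.mem_nil_iff, or_false] at hq
    rcases hq with rfl | rfl | rfl | rfl | rfl | rfl <;> exact norm_coe_sphere _
  exact norm_sum_im_six_le L hm hm2 (by simp [L]) hunit hre' him' hprod

end LatticeCube

end Summit.QuantumFields.BalabanUV.T4Continuum.NE7b.QuaternionBianchiDefect
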